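import Summits.QuantumFields.YangMills.Theorems.ParabolicTrajectoryTunedSequenceExistsQFemtoReduction

/-!
# Crux `TunedSequenceExists` (stmt-QuantumFields-10524) vs the sibling crux `FemtoCurvatureTwoPointC`
# (stmt-QuantumFields-16204): what the sibling gives INSIDE the femto window — the exact residue of the core (lead c5)

Two sharpenings of the package `…QFemtoBridge/…QFemtoReduction/…QNonFemto/…PNonFemto`:

* `rescaledQ_femto_volume_ratio` — **inside the femto window the rescaled `Q`-correlator is volume-independent up to the factor
  `C/c`**: for two femto tori `S, S'` at the same `(β, n)` (`S·aβ, S'·aβ ≤ ℓ₀`, `8n ≤ S, S'`), `c·(n⁸⟨Q;τ_nQ⟩_S) ≤ C·(n⁸⟨Q;τ_nQ⟩_{S'})`.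
  So the relative volume monotonicity (V_Q,rel) (`QFemto.VolumeMonotoneQRel`) is FREE between femto tori; its content is exactly the
  comparison ACROSS the femto radius (small femto torus vs. large non-femto torus), which is where every tuned witness lives
  (`PNonFemto.eventually_not_femto_of_tuned`).
* `coreQ_aspectwise_of_cruxCAtWith` — **the window lower bound with an ASPECT-DEPENDENT height follows from the sibling alone**: for
  every aspect floor `L₀ ≥ 4` there is `θ(L₀) > 0` such that beyond every coupling/depth floor some `(m, β)` has
  `θ(L₀) ≤ (M^m)⁸⟨Q;τ_{M^m}Q⟩_{β,2L+1}` for ALL `L₀M^m ≤ L ≤ 2L₀M^m` (choose the physical separation `ℓ₀/(4L₀+1)` so that all these tori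
  are femto).  The crux core for `Q` (`∃ θ₀ ∀ B m₀ L₀ ∃ …`, hypothesis of `RPDiagonalVariant.weakQ_of_lowerBound`) is the SAME statement with
  `θ₀` uniform in `L₀`: modulo stmt-16204, the entire content of the `Q`-crux core is the quantifier swap `∀ L₀ ∃ θ ↦ ∃ θ ∀ L₀` — and by
  `gamma_tendsto_zero_of_cruxCAtWith` the femto heights `θ(L₀) = c·Γ(ℓ₀/(4L₀+1))` themselves tend to `0`, so the swap is exactly the
  passage to non-femto volumes.
-/

noncomputable section

open Filter Topology MeasureTheory
open Literature.MathematicalPhysics.QuantumFieldTheory Literature.MathematicalPhysics.QuantumLattice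

namespace Summit.QuantumFields.YangMills.Theorems.TunedSequenceExists.QFemto

open RPDiagonalVariant (spatialPlaquette)

variable {G : Type} [Group G] [TopologicalSpace G] [IsTopologicalGroup G] [CompactSpace G]
  [MeasurableSpace G] [BorelSpace G]

/-- **Femto–femto volume independence up to `C/c`.** See the module docstring. -/
theorem rescaledQ_femto_volume_ratio (r : LatticeRep G) {a Γ : ℝ → ℝ} {β₀ ℓ₀ c C : ℝ}
    (h : CruxCAtWith r a Γ β₀ ℓ₀ c C) {β : ℝ} (hβ : β₀ ≤ β) (S S' : ℕ) [NeZero S] [NeZero S']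
    (hS : (S : ℝ) * a β ≤ ℓ₀) (hS' : (S' : ℝ) * a β ≤ ℓ₀) {n : ℕ} (hn : 1 ≤ n) (hnS : 8 * n ≤ S) (hnS' : 8 * n ≤ S') :
    c * ((n : ℝ) ^ 8 * latticeConnectedCorr r.ρ β S (spatialPlaquette r) (spatialPlaquette r) n) ≤
      C * ((n : ℝ) ^ 8 * latticeConnectedCorr r.ρ β S' (spatialPlaquette r) (spatialPlaquette r) n) := by
  have hc := h.2.1
  obtain ⟨-, hup⟩ := axis_window_of_cruxCAtWith r h S hβ hS hn hnS
  obtain ⟨hlow, hup'⟩ := axis_window_of_cruxCAtWith r h S' hβ hS' hn hnS'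
  -- `0 < Γ(n aβ)` and hence `0 ≤ C` from the instance at hand
  have hna : 0 < (n : ℝ) * a β := mul_pos (by exact_mod_cast hn) (h.2.2.1 β)
  have hnaℓ : (n : ℝ) * a β ≤ ℓ₀ := by
    have h8 : ((8 * n : ℕ) : ℝ) ≤ S := by exact_mod_cast hnS
    have : (n : ℝ) * a β ≤ (S : ℝ) * a β := by
      refine mul_le_mul_of_nonneg_right ?_ (h.2.2.1 β).le
      push_cast at h8; linarith
    exact this.trans hS
  have hΓ := (h.2.2.2.2.1 _ hna hnaℓ).1
  have hC : 0 ≤ C := by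
    have h1 : c * Γ ((n : ℝ) * a β) ≤ C * Γ ((n : ℝ) * a β) := hlow.trans hup'
    nlinarith
  calc c * ((n : ℝ) ^ 8 * latticeConnectedCorr r.ρ β S (spatialPlaquette r) (spatialPlaquette r) n)
      ≤ c * (C * Γ ((n : ℝ) * a β)) := mul_le_mul_of_nonneg_left hup hc.le
    _ = C * (c * Γ ((n : ℝ) * a β)) := by ring
    _ ≤ C * ((n : ℝ) ^ 8 * latticeConnectedCorr r.ρ β S' (spatialPlaquette r) (spatialPlaquette r) n) :=
        mul_le_mul_of_nonneg_left hlow hC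

/-- **The window lower bound with aspect-dependent height, from the sibling alone.** See the module docstring. -/
theorem coreQ_aspectwise_of_cruxCAtWith (r : LatticeRep G) {a Γ : ℝ → ℝ} {β₀ ℓ₀ c C : ℝ}
    (h : CruxCAtWith r a Γ β₀ ℓ₀ c C) (ha : Continuous a) {M : ℕ} (hM : 2 ≤ M) {L₀ : ℕ} (hL₀ : 4 ≤ L₀) :
    ∃ θ : ℝ, 0 < θ ∧ ∀ (B : ℝ) (m₀ : ℕ), ∃ m : ℕ, m₀ ≤ m ∧ ∃ β : ℝ, B ≤ β ∧
      ∀ L : ℕ, L₀ * M ^ m ≤ L → L ≤ 2 * (L₀ * M ^ m) →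
        θ ≤ ((M : ℝ) ^ m) ^ 8 *
          latticeConnectedCorr r.ρ β (2 * L + 1) (spatialPlaquette r) (spatialPlaquette r) (M ^ m) := by
  have hℓ₀ := h.1
  have hc := h.2.1
  have hapos := h.2.2.1
  have hatend := h.2.2.2.1
  have hΓ := h.2.2.2.2.1
  have hM1 : (1 : ℝ) < M := by exact_mod_cast hM
  -- physical separation `s = ℓ₀ / (4 L₀ + 1)`: every torus `2L+1 ≤ (4L₀+1)·n` is femto when `n·a β = s`
  set s : ℝ := ℓ₀ / (4 * L₀ + 1) with hs_def
  have hL₀pos : (0 : ℝ) < 4 * L₀ + 1 := by positivity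
  have hs : 0 < s := div_pos hℓ₀ hL₀pos
  have hsℓ : s ≤ ℓ₀ := by
    rw [hs_def, div_le_iff₀ hL₀pos]
    have h1 : (1 : ℝ) ≤ 4 * L₀ + 1 := by linarith [(Nat.cast_nonneg L₀ : (0 : ℝ) ≤ L₀)]
    nlinarith
  refine ⟨c * Γ s, mul_pos hc (hΓ s hs hsℓ).1, fun B m₀ => ?_⟩
  set B' : ℝ := max B β₀ with hB'
  have haB' := hapos B'
  obtain ⟨m₁, hm₁⟩ := eventually_atTop.1
    ((tendsto_pow_atTop_atTop_of_one_lt hM1).eventually (eventually_ge_atTop (s / a B')))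
  set m : ℕ := max m₀ m₁ with hm_def
  have hpow : s / a B' ≤ (M : ℝ) ^ m := hm₁ m (le_max_right _ _)
  have hMm_pos : (0 : ℝ) < (M : ℝ) ^ m := by positivity
  set n : ℕ := M ^ m with hn_def
  have hn_cast : (n : ℝ) = (M : ℝ) ^ m := by rw [hn_def]; push_cast; ring
  have hn_pos : (0 : ℝ) < n := by rw [hn_cast]; exact hMm_pos
  have hn1 : 1 ≤ n := Nat.one_le_pow _ _ (by omega)
  have hsn : 0 < s / n := div_pos hs hn_pos
  have hsnB : s / n ≤ a B' := by
    rw [div_le_iff₀ hn_pos, hn_cast]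
    rw [div_le_iff₀ haB'] at hpow
    linarith [mul_comm (a B') ((M : ℝ) ^ m)]
  obtain ⟨β, hB'β, hβs⟩ := exists_ge_unitMap_eq ha hatend B' hsn hsnB
  have hBβ : B ≤ β := (le_max_left _ _).trans hB'β
  have hβ₀ : β₀ ≤ β := (le_max_right _ _).trans hB'β
  refine ⟨m, le_max_left _ _, β, hBβ, fun L hL hL2 => ?_⟩
  rw [← hn_def] at hL hL2
  -- the torus `2L+1` is femto and `8 n ≤ 2L+1`
  have hfem : ((2 * L + 1 : ℕ) : ℝ) * a β ≤ ℓ₀ := by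
    rw [hβs]
    have h1 : ((2 * L + 1 : ℕ) : ℝ) ≤ (4 * L₀ + 1) * n := by
      have h2' : 2 * L + 1 ≤ 2 * (2 * (L₀ * n)) + 1 := by omega
      have h2 : ((2 * L + 1 : ℕ) : ℝ) ≤ 2 * (2 * ((L₀ : ℝ) * n)) + 1 := by exact_mod_cast h2'
      have : (1 : ℝ) ≤ n := by exact_mod_cast hn1
      push_cast at h2 ⊢
      nlinarith [(Nat.cast_nonneg L₀ : (0 : ℝ) ≤ L₀)]
    calc ((2 * L + 1 : ℕ) : ℝ) * (s / n)
        ≤ (4 * L₀ + 1) * n * (s / n) := mul_le_mul_of_nonneg_right h1 hsn.le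
      _ = (4 * L₀ + 1) * s := by field_simp
      _ = ℓ₀ := by rw [hs_def]; field_simp
  have h8 : 8 * n ≤ 2 * L + 1 := by
    have : 8 * n ≤ 2 * (L₀ * n) := by nlinarith
    omega
  have hwin := (axis_window_of_cruxCAtWith r h (2 * L + 1) hβ₀ hfem hn1 h8).1
  have hns : (n : ℝ) * a β = s := by
    rw [hβs]; field_simp
  rw [hns, hn_cast] at hwin
  exact hwin

end Summit.QuantumFields.YangMills.Theorems.TunedSequenceExists.QFemto

end
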